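import Literature.NumberTheory.Transcendental.KontsevichZagier
import HarnessLib

/-!
# Kontsevich–Zagier periods: `√π` is an exponential period (discharge of a named fact)

Proof of the named fact `Literature.NumberTheory.Transcendental.isExponentialPeriod_sqrt_pi`
stated in `Literature.NumberTheory.Transcendental.KontsevichZagier` (periods.S32), kept in this
sibling file so that the statements file stays untouched (the statement is the `def … : Prop` of
that file, unchanged).

## Main statements

* `Literature.NumberTheory.Transcendental.isRealExponentialPeriod_sqrt_pi` — `√π` is a real
  exponential period: the datum `(n, σ, f, p, q) = (1, ℝ¹, x₀², 1, 1)` of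
  `Literature.NumberTheory.Transcendental.IsRealExponentialPeriod`.
* `Literature.NumberTheory.Transcendental.isExponentialPeriod_sqrt_pi_holds` — discharge of
  `isExponentialPeriod_sqrt_pi`: `√π ∈ ℂ` is an exponential period in the sense of
  Kontsevich–Zagier.

## Proof

Kontsevich–Zagier [2001, §4.3, pp. 34–35 of the IHÉS text], right after the Definition of
exponential periods ("an absolutely convergent integral of the product of an algebraic function
with the exponent of an algebraic function, over a real semi-algebraic set, where all polynomials
entering the definition have algebraic coefficients"): "As a simple example, if `X = A¹`, `D = ∅`
and `f(x) = x²`, then the period matrix has size `1 × 1` and its only element is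
`√π = ∫_{-∞}^{+∞} exp(-x²) dx`." In the terms of
`Literature.NumberTheory.Transcendental.IsRealExponentialPeriod` (`∫_σ e^{-f} p/q` with
`f, p, q ∈ ℚ[x₀, …, x_{n-1}]`, `σ ⊆ ℝⁿ` `ℚ`-semialgebraic, `q ≠ 0` on `σ`, absolutely convergent)
this is the datum `(n, σ, f, p, q) = (1, ℝ¹, x₀², 1, 1)`. The only analytic input is the Gaussian
integral `∫_ℝ e^{-x²} dx = √π` together with its absolute convergence — Mathlib's
`integral_gaussian` and `integrable_exp_neg_mul_sq` at `b = 1` — transported along the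
measure-preserving equivalence `(Fin 1 → ℝ) ≃ᵐ ℝ` (`MeasureTheory.volume_preserving_funUnique`).
The imaginary part `0` of the real number `√π` is a real exponential period because every period
is an exponential period (`IsPeriod.isExponentialPeriod`, `IsPeriod.zero`).

## References

* M. Kontsevich, D. Zagier, *Periods*, in: Mathematics Unlimited — 2001 and Beyond, Springer
  (2001), 771–808 (IHÉS preprint IHES/M/01/22, May 2001), §4.3 "Exponential periods", the
  Definition and the example following it.
-/

noncomputable section

open MvPolynomial Set
open _root_.MeasureTheory

namespace Literature.NumberTheory.Transcendental

/-- The Gaussian integral on `ℝ¹ = (Fin 1 → ℝ)` with its product Lebesgue measure: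
`∫ y, e^{-(y 0)²} dy = √π` (`integral_gaussian` at `b = 1`, transported along
`MeasurableEquiv.funUnique (Fin 1) ℝ`). [Kontsevich–Zagier 2001, §4.3] [cite: KontsevichZagier2001, §4.3] -/
theorem integral_exp_neg_sq_finOne :
    ∫ y : Fin 1 → ℝ, Real.exp (-(y 0 ^ 2)) = Real.sqrt Real.pi := by
  have h := (volume_preserving_funUnique (Fin 1) ℝ).integral_comp'
    (fun x : ℝ => Real.exp (-(x ^ 2)))
  have hg : ∫ x : ℝ, Real.exp (-(x ^ 2)) = Real.sqrt Real.pi := by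
    simpa using integral_gaussian 1
  exact h.trans hg

/-- The Gaussian `y ↦ e^{-(y 0)²}` is integrable on `ℝ¹ = (Fin 1 → ℝ)`
(`integrable_exp_neg_mul_sq` at `b = 1`, pulled back along `MeasurableEquiv.funUnique (Fin 1) ℝ`).
[Kontsevich–Zagier 2001, §4.3] [cite: KontsevichZagier2001, §4.3] -/
theorem integrable_exp_neg_sq_finOne :
    Integrable (fun y : Fin 1 → ℝ => Real.exp (-(y 0 ^ 2))) := by
  have hg : Integrable (fun x : ℝ => Real.exp (-(x ^ 2))) := by
    simpa using integrable_exp_neg_mul_sq (b := 1) one_pos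
  have h := (volume_preserving_funUnique (Fin 1) ℝ).integrable_comp_of_integrable hg
  exact h

/-- **`√π` is a real exponential period**: `√π = ∫_{ℝ¹} e^{-x₀²} · 1 / 1`, the datum
`(n, σ, f, p, q) = (1, ℝ¹, x₀², 1, 1)` of `IsRealExponentialPeriod`.
[Kontsevich–Zagier 2001, §4.3, example after the Definition (`X = A¹`, `D = ∅`, `f(x) = x²`):
"`√π = ∫_{-∞}^{+∞} exp(-x²) dx`"] [cite: KontsevichZagier2001, §4.3] -/
theorem isRealExponentialPeriod_sqrt_pi : IsRealExponentialPeriod (Real.sqrt Real.pi) := by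
  refine ⟨1, Set.univ, X 0 ^ 2, 1, 1,
    Literature.ModelTheory.ExponentialFields.isSemialgebraic_univ, fun y _ => by simp, ?_, ?_⟩
  · simpa only [map_pow, aeval_X, map_one, mul_one, div_one, integrableOn_univ] using
      integrable_exp_neg_sq_finOne
  · simp only [map_pow, aeval_X, map_one, mul_one, div_one, Measure.restrict_univ]
    exact integral_exp_neg_sq_finOne.symm

/-- Discharge of `isExponentialPeriod_sqrt_pi`: **`√π = ∫_{-∞}^{+∞} e^{-x²} dx` is an exponential
period** — its real part `√π` is the real exponential period `isRealExponentialPeriod_sqrt_pi`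
(datum `n = 1`, `σ = ℝ¹`, `f = x₀²`, `p = q = 1`) and its imaginary part `0` is one because every
period is an exponential period (`IsPeriod.isExponentialPeriod IsPeriod.zero`).
[Kontsevich–Zagier 2001, §4.3, the example right after the Definition of exponential periods:
"if `X = A¹`, `D = ∅` and `f(x) = x²`, then the period matrix has size `1 × 1` and its only
element is `√π = ∫_{-∞}^{+∞} exp(-x²) dx`"; IHÉS preprint IHES/M/01/22, pp. 34–35]
[cite: KontsevichZagier2001, §4.3] -/
theorem isExponentialPeriod_sqrt_pi_holds : isExponentialPeriod_sqrt_pi :=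
  ⟨by simpa using isRealExponentialPeriod_sqrt_pi,
    by simpa using (IsPeriod.isExponentialPeriod IsPeriod.zero).2⟩

/-- Sanity check of the coercion convention in `isExponentialPeriod_sqrt_pi`: the statement is
about the real number `Real.sqrt Real.pi` coerced to `ℂ`, whose square is `π`. -/
example : ((Real.sqrt Real.pi : ℂ)) ^ 2 = (Real.pi : ℂ) := by
  rw [← Complex.ofReal_pow, Real.sq_sqrt Real.pi_pos.le]

end Literature.NumberTheory.Transcendental
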